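import Summits.NavierStokesRegularity.NavierStokesRegularity.Theorems.ScenarioCensusDiffusionMeter
import HarnessLib

/-!
# LINE «diffusion-meter» port, part 2/2: the fine part (caloric FTC, §D), the squeeze and the endgame (§E), the rows (§F) and verdicts (§G); census KEYS `Row_A2ml` /
# `Row_A2cd` / `Row_A2cdb` / `Row_A2lap` / `Row_A2lapb` + `_excluded`, `Row_A2lapU` / `Row_A2cdU` (OPEN)

Re-homed for the scenario census (typer seat ns-census-typer-1 g8; cells of ns-idea-2 g15 LINE «diffusion-meter», text of record 00368bf2689bd8ac after the re-key
A2cl → A2ml (05:27Z), critic idea-crit-3 g8 PASS, members OF RECORD since census v1.82 / v1.84; this port makes the decided cells TREE-decided): VERBATIM PORT of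
`pub/ideators/ns-idea-2/lines/diffusion-meter/line-diffusion-meter.lean` sha16 00368bf2689bd8ac (534 l., lean check rc 0, 0 sorry), split for the 400-line rule into
`ScenarioCensusDiffusionMeter` (§A–§C) → `…DiffusionMeterRows` (§D–§G + census KEYS).  Lean text VERBATIM in namespace `…Theorems.ScenarioCensus.DiffusionMeter` (the
line's `…Lines.DiffusionMeter` re-homed); port edits: `local notation "E3"` → `abbrev E3` (typer lint: no notation in port files), `@[conjecture]` on the OPEN rows
`Row_A2lapU` / `Row_A2cdU` (typed only), six one-line docstrings added (gate lint); the Cauchy–Schwarz twin `lintegral_unitBall_enorm_le_sqrt'` (≡ the Literature lemma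
`BarkerPrange2020.lintegral_unitBall_enorm_le_sqrt`, whose module `HeatExtensionFarFieldUloc` the farm does not build at port time) is not re-declared: its own proof is
carried inline at its single use in `exists_gauss_unit_bound` (proof text only).  Statements untouched.

No census VALUE is moved here (the cells become TREE-decided by name; booking is the lead's); NS regularity is NOT proved; (L′) ⟨10661⟩ is untouched; no summit
statement is proved by this file.
-/

-- the summit and its single problem share the name `NavierStokesRegularity` (D-0017 nested layout)
set_option linter.dupNamespace false

noncomputable section

open Set Function Filter Topology Metric MeasureTheory
open scoped RealInnerProductSpace ENNReal NNReal Laplacian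

namespace Summit.NavierStokesRegularity.NavierStokesRegularity.Theorems.ScenarioCensus.DiffusionMeter

open Literature.Analysis Literature.Analysis.FluidPDE Literature.Analysis.UnboundedOperators
open Summit.NavierStokesRegularity.NavierStokesRegularity.Theorems
open Summit.NavierStokesRegularity.NavierStokesRegularity.Theorems.SimilarityEnstrophy
  (typeI_ancient_eq_zero_of_rate_lt_one)
open Summit.NavierStokesRegularity.NavierStokesRegularity.Theorems.SymmetryModuliCountSymmetricLiouville
  (vanishes_of_vanishes_before)

/-! ## D. The fine part: caloric FTC `‖e^{sΔ}f − f‖ ≤ s ‖Δf‖_∞` -/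

/-- **Caloric FTC.** For `f ∈ C²` with two bounded derivatives and `‖Δf‖ ≤ B`:
`‖e^{sΔ}f(x) − f(x)‖ ≤ s·B` (`e^{sΔ}f − e^{aΔ}f = ∫_a^s Δe^{σΔ}f dσ = ∫_a^s e^{σΔ}Δf dσ`, each
integrand of norm `≤ B`, then `a ↓ 0`). -/
theorem norm_heatExtension_sub_self_le {f : E3 → E3} (hf : ContDiff ℝ 2 f) {C₀ C₁ C₂ B : ℝ}
    (h0 : ∀ z, ‖f z‖ ≤ C₀) (h1 : ∀ z, ‖fderiv ℝ f z‖ ≤ C₁)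
    (h2 : ∀ z, ‖fderiv ℝ (fderiv ℝ f) z‖ ≤ C₂) (hB : ∀ z, ‖(Δ f) z‖ ≤ B)
    {s : ℝ} (hs : 0 < s) (x : E3) : ‖heatExtension f s x - f x‖ ≤ s * B := by
  have hmem : MemLp f ∞ (volume : Measure E3) := memLp_top_of_continuous_of_bound hf.continuous h0
  have hB0 : 0 ≤ B := (norm_nonneg _).trans (hB x)
  -- the bound at positive small times `a`
  have hstep : ∀ a ∈ Ioc (0 : ℝ) s, ‖heatExtension f s x - heatExtension f a x‖ ≤ s * B := by
    intro a ha
    rw [heatExtension_sub_eq_integral_laplacian hmem le_top ha.1 ha.2 x]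
    have hle : ‖∫ σ in a..s, (Δ (heatExtension f σ)) x‖ ≤ B * |s - a| := by
      refine intervalIntegral.norm_integral_le_of_norm_le_const fun σ hσ => ?_
      rw [uIoc_of_le ha.2] at hσ
      rw [laplacian_heatExtension_of_bounded hf h0 h1 h2 (ha.1.trans hσ.1) x]
      exact norm_heatExtension_le hB (ha.1.trans hσ.1) x
    refine hle.trans ?_
    rw [abs_of_nonneg (by linarith [ha.2]), mul_comm]
    exact mul_le_mul_of_nonneg_right (by linarith [ha.1]) hB0
  -- pass to the limit `a ↓ 0`
  have hlim : Tendsto (fun a : ℝ => ‖heatExtension f s x - heatExtension f a x‖) (𝓝[>] 0)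
      (𝓝 ‖heatExtension f s x - f x‖) :=
    (tendsto_const_nhds.sub (tendsto_heatExtension_nhdsGT_zero_of_continuousAt hmem le_top
      (hf.continuous.continuousAt))).norm
  exact le_of_tendsto hlim (mem_of_superset (Ioc_mem_nhdsGT hs) fun a ha => hstep a ha)

/-- Class-uniform bounds on the first two derivatives of a slice of an element of `A_C` (KNSS
gauge bounds, via the tree's `exists_norm_iteratedFDeriv_le_of_typeI`; qualitative use only). -/
theorem slice_deriv_bounds {C : ℝ} {u : ℝ → E3 → E3} (hu : IsTypeIAncientMild C u) {t : ℝ}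
    (ht : t < 0) : ∃ C₁ C₂ : ℝ, (∀ z, ‖fderiv ℝ (u t) z‖ ≤ C₁) ∧
      (∀ z, ‖fderiv ℝ (fderiv ℝ (u t)) z‖ ≤ C₂) := by
  obtain ⟨K₁, hK₁⟩ := exists_norm_iteratedFDeriv_le_of_typeI C 1 (a := t + t) (b := t / 2)
    (δ := -t) (by linarith) (by linarith) (by linarith)
  obtain ⟨K₂, hK₂⟩ := exists_norm_iteratedFDeriv_le_of_typeI C 2 (a := t + t) (b := t / 2)
    (δ := -t) (by linarith) (by linarith) (by linarith)
  have htI : t ∈ Ico (t + t + -t) (t / 2) := ⟨by linarith, by linarith⟩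
  have hmild : ∀ s t : ℝ, s < t → t < 0 → ∀ x,
      u t x = heatExtension (u s) (t - s) x - oseenDuhamel 1 s u u t x :=
    fun s t hst ht x => hu.mild_eq_heatExtension hst ht x
  refine ⟨K₁, K₂, fun z => ?_, fun z => ?_⟩
  · have h := hK₁ hu.continuousOn_uncurry (fun t ht => hu.isWeaklyDivFree ht) hmild
      hu.hasTypeITimeDecay t htI z
    rwa [← norm_iteratedFDeriv_fderiv, norm_iteratedFDeriv_zero] at h
  · have h := hK₂ hu.continuousOn_uncurry (fun t ht => hu.isWeaklyDivFree ht) hmild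
      hu.hasTypeITimeDecay t htI z
    rwa [← norm_iteratedFDeriv_fderiv, ← norm_iteratedFDeriv_fderiv, norm_iteratedFDeriv_zero] at h

/-! ## E. The squeeze and the endgame -/

/-- **Endgame (tree theorems only).**  Scale-invariant smallness `√(-τ)‖u(τ,x)‖ ≤ m < 1` on a
backward end `τ < T₀ ≤ 0` forces `u ≡ 0`: the backward shift `t ↦ u(t + T₀ - 1)` lies in the class
with constant `m` (`IsTypeIAncientMild.comp_sub_right` + the improved decay), the tree's
time-only threshold theorem `typeI_ancient_eq_zero_of_rate_lt_one` (census A2a) kills it, and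
forward uniqueness `vanishes_of_vanishes_before` carries the vanishing up to `t < 0`.
(Verbatim from the g14 line «deviator-meter».) -/
theorem eq_zero_of_small_backward_end {C : ℝ} {u : ℝ → E3 → E3} (h : IsTypeIAncientMild C u)
    {T₀ m : ℝ} (hT₀ : T₀ ≤ 0) (hm : m < 1)
    (hsmall : ∀ τ < T₀, ∀ x, Real.sqrt (-τ) * ‖u τ x‖ ≤ m) : ∀ t < 0, ∀ x, u t x = 0 := by
  set δ : ℝ := 1 - T₀ with hδ
  have hδ0 : 0 ≤ δ := by rw [hδ]; linarith
  have hv : IsTypeIAncientMild C (fun t => u (t - δ)) := h.comp_sub_right hδ0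
  have hv' : IsTypeIAncientMild m (fun t => u (t - δ)) := by
    refine ⟨hv.1, hv.2.1, hv.2.2.1, fun t ht x => ?_⟩
    have hτ : t - δ < T₀ := by rw [hδ]; linarith
    have hs0 : 0 < Real.sqrt (-t) := Real.sqrt_pos.2 (by linarith)
    have hst : Real.sqrt (-t) ≤ Real.sqrt (-(t - δ)) := Real.sqrt_le_sqrt (by linarith)
    have key := hsmall _ hτ x
    rw [le_div_iff₀ hs0]
    calc ‖u (t - δ) x‖ * Real.sqrt (-t) ≤ ‖u (t - δ) x‖ * Real.sqrt (-(t - δ)) :=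
          mul_le_mul_of_nonneg_left hst (norm_nonneg _)
      _ ≤ m := by rw [mul_comm]; exact key
  have hz := typeI_ancient_eq_zero_of_rate_lt_one hv' hm
  refine vanishes_of_vanishes_before h (by linarith : T₀ - 1 < 0) (fun t ht x => ?_)
  have := hz (t + δ) (by rw [hδ]; linarith) x
  simpa using this

/-- **The squeeze, caloric-defect form.** If `‖e^{sΔ}u(t)‖ ≤ L/√s` for all `s > 0` (coarse law)
and the caloric defect at scale `Λ(−t)` is `≤ d/√(−t)`, then `√(−t)‖u(t,x)‖ ≤ d + L/√Λ`. -/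
theorem amplitude_le_of_defect {u : ℝ → E3 → E3} {L : ℝ}
    (hL : ∀ t < 0, ∀ s : ℝ, 0 < s → ∀ x, ‖heatExtension (u t) s x‖ ≤ L / Real.sqrt s)
    {Λ : ℝ} (hΛ : 0 < Λ) {t : ℝ} (ht : t < 0) {d : ℝ} (x : E3)
    (hdef : Real.sqrt (-t) * ‖u t x - heatExtension (u t) (Λ * (-t)) x‖ ≤ d) :
    Real.sqrt (-t) * ‖u t x‖ ≤ d + L / Real.sqrt Λ := by
  have hmt : 0 < -t := by linarith
  have hs : 0 < Λ * (-t) := mul_pos hΛ hmt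
  have hsq : 0 < Real.sqrt (-t) := Real.sqrt_pos.2 hmt
  have hsΛ : 0 < Real.sqrt Λ := Real.sqrt_pos.2 hΛ
  have hc := hL t ht (Λ * (-t)) hs x
  have htri : ‖u t x‖ ≤ ‖u t x - heatExtension (u t) (Λ * (-t)) x‖ +
      ‖heatExtension (u t) (Λ * (-t)) x‖ := by
    have := norm_add_le (u t x - heatExtension (u t) (Λ * (-t)) x)
      (heatExtension (u t) (Λ * (-t)) x)
    rwa [sub_add_cancel] at this
  have hsplit : Real.sqrt (Λ * (-t)) = Real.sqrt Λ * Real.sqrt (-t) := Real.sqrt_mul hΛ.le _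
  have hcoarse : Real.sqrt (-t) * ‖heatExtension (u t) (Λ * (-t)) x‖ ≤ L / Real.sqrt Λ := by
    rw [hsplit] at hc
    rw [le_div_iff₀ hsΛ]
    calc Real.sqrt (-t) * ‖heatExtension (u t) (Λ * (-t)) x‖ * Real.sqrt Λ
        = (Real.sqrt Λ * Real.sqrt (-t)) * ‖heatExtension (u t) (Λ * (-t)) x‖ := by ring
      _ ≤ (Real.sqrt Λ * Real.sqrt (-t)) * (L / (Real.sqrt Λ * Real.sqrt (-t))) :=
          mul_le_mul_of_nonneg_left hc (by positivity)
      _ = L := mul_div_cancel₀ L (by positivity)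
  calc Real.sqrt (-t) * ‖u t x‖
      ≤ Real.sqrt (-t) * (‖u t x - heatExtension (u t) (Λ * (-t)) x‖ +
          ‖heatExtension (u t) (Λ * (-t)) x‖) := mul_le_mul_of_nonneg_left htri hsq.le
    _ = Real.sqrt (-t) * ‖u t x - heatExtension (u t) (Λ * (-t)) x‖ +
          Real.sqrt (-t) * ‖heatExtension (u t) (Λ * (-t)) x‖ := mul_add _ _ _
    _ ≤ d + L / Real.sqrt Λ := add_le_add hdef hcoarse

/-- **From viscous force to caloric defect.** For `u ∈ A_C`, `t < 0`, if
`(−t)√(−t)‖Δu(t)‖ ≤ γ` everywhere then the caloric defect at scale `Λ(−t)` satisfies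
`√(−t)‖u(t,x) − e^{Λ(−t)Δ}u(t)(x)‖ ≤ Λγ`. -/
theorem defect_le_of_laplacian {C : ℝ} {u : ℝ → E3 → E3} (hu : IsTypeIAncientMild C u) {t : ℝ}
    (ht : t < 0) {γ : ℝ} (hlap : ∀ x, (-t) * Real.sqrt (-t) * ‖(Δ (u t)) x‖ ≤ γ)
    {Λ : ℝ} (hΛ : 0 < Λ) (x : E3) :
    Real.sqrt (-t) * ‖u t x - heatExtension (u t) (Λ * (-t)) x‖ ≤ Λ * γ := by
  have hmt : 0 < -t := by linarith
  have hsq : 0 < Real.sqrt (-t) := Real.sqrt_pos.2 hmt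
  have hden : 0 < (-t) * Real.sqrt (-t) := mul_pos hmt hsq
  obtain ⟨C₁, C₂, h1, h2⟩ := slice_deriv_bounds hu ht
  have hB : ∀ z, ‖(Δ (u t)) z‖ ≤ γ / ((-t) * Real.sqrt (-t)) := fun z => by
    rw [le_div_iff₀ hden]
    have := hlap z
    linarith [mul_comm ((-t) * Real.sqrt (-t)) ‖(Δ (u t)) z‖]
  have hfine := norm_heatExtension_sub_self_le ((hu.contDiff_slice ht).of_le (by norm_cast))
    (fun z => hu.norm_le ht z) h1 h2 hB (mul_pos hΛ hmt) x
  rw [← norm_neg, neg_sub] at hfine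
  calc Real.sqrt (-t) * ‖u t x - heatExtension (u t) (Λ * (-t)) x‖
      ≤ Real.sqrt (-t) * (Λ * (-t) * (γ / ((-t) * Real.sqrt (-t)))) :=
        mul_le_mul_of_nonneg_left hfine hsq.le
    _ = Λ * γ := by
        have htne : t ≠ 0 := ht.ne
        have hsne : Real.sqrt (-t) ≠ 0 := hsq.ne'
        field_simp

/-! ## F. The rows -/

/-- Row A2ml · COARSE (MORREY) LAW (structural; PROVED below): the caloric extension of every slice of every
element of `A_C` obeys `√s ‖e^{sΔ}u(t)(x)‖ ≤ L(C)` at EVERY heat time `s > 0`. -/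
def Row_A2ml : Prop :=
  ∀ C : ℝ, ∃ L : ℝ, ∀ u : ℝ → E3 → E3, IsTypeIAncientMild C u →
    ∀ t < 0, ∀ s : ℝ, 0 < s → ∀ x : E3, Real.sqrt s * ‖heatExtension (u t) s x‖ ≤ L

/-- Row A2cd · CALORIC-DEFECT CELL (scale `Λ(C)`, universal amplitude `1/4`; PROVED below): an
element of `A_C` whose every slice is within `1/(4√(−t))` of its own coarse-graining at heat time
`Λ(C)(−t)` vanishes identically. -/
def Row_A2cd : Prop :=
  ∀ C : ℝ, ∃ Λ : ℝ, 0 < Λ ∧ ∀ u : ℝ → E3 → E3, IsTypeIAncientMild C u →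
    (∀ t < 0, ∀ x : E3,
      Real.sqrt (-t) * ‖u t x - heatExtension (u t) (Λ * (-t)) x‖ ≤ 1 / 4) →
    ∀ t < 0, ∀ x, u t x = 0

/-- Row A2cdb · the caloric-defect cell on a BACKWARD END `t < T` (PROVED below). -/
def Row_A2cdb : Prop :=
  ∀ C : ℝ, ∃ Λ : ℝ, 0 < Λ ∧ ∀ u : ℝ → E3 → E3, IsTypeIAncientMild C u →
    (∃ T ≤ (0 : ℝ), ∀ t < T, ∀ x : E3,
      Real.sqrt (-t) * ‖u t x - heatExtension (u t) (Λ * (-t)) x‖ ≤ 1 / 4) →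
    ∀ t < 0, ∀ x, u t x = 0

/-- Row A2lap · VISCOUS-FORCE CELL (threshold `γ(C)`; PROVED below): an element of `A_C` with
scale-invariant viscous force `(−t)^{3/2}‖Δu(t,x)‖ ≤ γ(C)` everywhere vanishes identically. -/
def Row_A2lap : Prop :=
  ∀ C : ℝ, ∃ γ : ℝ, 0 < γ ∧ ∀ u : ℝ → E3 → E3, IsTypeIAncientMild C u →
    (∀ t < 0, ∀ x : E3, (-t) * Real.sqrt (-t) * ‖(Δ (u t)) x‖ ≤ γ) →
    ∀ t < 0, ∀ x, u t x = 0

/-- Row A2lapb · the viscous-force cell on a BACKWARD END `t < T` (PROVED below). -/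
def Row_A2lapb : Prop :=
  ∀ C : ℝ, ∃ γ : ℝ, 0 < γ ∧ ∀ u : ℝ → E3 → E3, IsTypeIAncientMild C u →
    (∃ T ≤ (0 : ℝ), ∀ t < T, ∀ x : E3, (-t) * Real.sqrt (-t) * ‖(Δ (u t)) x‖ ≤ γ) →
    ∀ t < 0, ∀ x, u t x = 0

/-- Row A2lapU · UNIVERSAL viscous-force threshold (OPEN; typed only): one `γ > 0` serving every
constant `C`.  Why it might fail: the squeeze's `γ(C) = 1/(64(L(C)+1)²)` degenerates as the ledger
constant grows; a universal threshold needs a scale-selection argument not available here. -/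
@[conjecture] def Row_A2lapU : Prop :=
  ∃ γ : ℝ, 0 < γ ∧ ∀ (C : ℝ) (u : ℝ → E3 → E3), IsTypeIAncientMild C u →
    (∀ t < 0, ∀ x : E3, (-t) * Real.sqrt (-t) * ‖(Δ (u t)) x‖ ≤ γ) →
    ∀ t < 0, ∀ x, u t x = 0

/-- Row A2cdU · UNIVERSAL caloric scale (OPEN; typed only): one `Λ > 0` serving every `C`. -/
@[conjecture] def Row_A2cdU : Prop :=
  ∃ Λ : ℝ, 0 < Λ ∧ ∀ (C : ℝ) (u : ℝ → E3 → E3), IsTypeIAncientMild C u →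
    (∀ t < 0, ∀ x : E3,
      Real.sqrt (-t) * ‖u t x - heatExtension (u t) (Λ * (-t)) x‖ ≤ 1 / 4) →
    ∀ t < 0, ∀ x, u t x = 0

/-! ## G. Verdicts -/

/-- **Row A2ml holds** (the coarse Morrey law). -/
theorem row_A2ml : Row_A2ml := by
  intro C
  obtain ⟨L, hL0, hL⟩ := coarse_bound C
  refine ⟨L, fun u hu t ht s hs x => ?_⟩
  have hsq : 0 < Real.sqrt s := Real.sqrt_pos.2 hs
  have h := hL u hu t ht s hs x
  rw [le_div_iff₀ hsq] at h
  linarith [mul_comm (Real.sqrt s) ‖heatExtension (u t) s x‖]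

/-- The scale of the squeeze: `Λ(C) = 16 (L(C)+1)²`, so that `L/√Λ = L/(4(L+1)) ≤ 1/4`. -/
theorem coarse_quarter {L : ℝ} (hL0 : 0 ≤ L) : L / Real.sqrt (16 * (L + 1) ^ 2) ≤ 1 / 4 := by
  have hsq : Real.sqrt (16 * (L + 1) ^ 2) = 4 * (L + 1) := by
    rw [show (16 : ℝ) * (L + 1) ^ 2 = (4 * (L + 1)) ^ 2 by ring]
    exact Real.sqrt_sq (by linarith)
  rw [hsq, div_le_div_iff₀ (by linarith) (by norm_num)]
  linarith

/-- **Row A2cdb holds.** -/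
theorem row_A2cdb : Row_A2cdb := by
  intro C
  obtain ⟨L, hL0, hL⟩ := coarse_bound C
  refine ⟨16 * (L + 1) ^ 2, by positivity, fun u hu ⟨T, hT0, hT⟩ => ?_⟩
  refine eq_zero_of_small_backward_end hu hT0 (m := 1 / 4 + 1 / 4) (by norm_num) fun t ht x => ?_
  have ht0 : t < 0 := lt_of_lt_of_le ht hT0
  exact (amplitude_le_of_defect (hL u hu) (by positivity) ht0 x (hT t ht x)).trans
    (add_le_add le_rfl (coarse_quarter hL0))

/-- **Row A2cd holds.** -/
theorem row_A2cd : Row_A2cd := by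
  intro C
  obtain ⟨Λ, hΛ, h⟩ := row_A2cdb C
  exact ⟨Λ, hΛ, fun u hu hyp => h u hu ⟨0, le_rfl, fun t ht x => hyp t ht x⟩⟩

/-- **Row A2lapb holds.** -/
theorem row_A2lapb : Row_A2lapb := by
  intro C
  obtain ⟨L, hL0, hL⟩ := coarse_bound C
  set Λ : ℝ := 16 * (L + 1) ^ 2 with hΛdef
  have hΛ : 0 < Λ := by positivity
  refine ⟨1 / (4 * Λ), by positivity, fun u hu ⟨T, hT0, hT⟩ => ?_⟩
  refine eq_zero_of_small_backward_end hu hT0 (m := 1 / 4 + 1 / 4) (by norm_num) fun t ht x => ?_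
  have ht0 : t < 0 := lt_of_lt_of_le ht hT0
  have hdef := defect_le_of_laplacian hu ht0 (hT t ht) hΛ x
  have hq : Λ * (1 / (4 * Λ)) = 1 / 4 := by field_simp
  rw [hq] at hdef
  exact (amplitude_le_of_defect (hL u hu) hΛ ht0 x hdef).trans
    (add_le_add le_rfl (coarse_quarter hL0))

/-- **Row A2lap holds.** -/
theorem row_A2lap : Row_A2lap := by
  intro C
  obtain ⟨γ, hγ, h⟩ := row_A2lapb C
  exact ⟨γ, hγ, fun u hu hyp => h u hu ⟨0, le_rfl, fun t ht x => hyp t ht x⟩⟩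

/-- Nesting: a universal threshold gives the `C`-dependent one. -/
theorem row_A2lapU_imp : Row_A2lapU → Row_A2lap := fun ⟨γ, hγ, h⟩ C => ⟨γ, hγ, h C⟩

/-- Nesting: a universal caloric scale gives the `C`-dependent one. -/
theorem row_A2cdU_imp : Row_A2cdU → Row_A2cd := fun ⟨Λ, hΛ, h⟩ C => ⟨Λ, hΛ, h C⟩

/-- (L′) itself implies every OPEN universal cell (they are weakenings of the rung). -/
theorem row_A2lapU_of_L' (h : ∀ (C : ℝ) (u : ℝ → E3 → E3), IsTypeIAncientMild C u →
    ∀ t < 0, ∀ x, u t x = 0) : Row_A2lapU :=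
  ⟨1, one_pos, fun C u hu _ => h C u hu⟩

end Summit.NavierStokesRegularity.NavierStokesRegularity.Theorems.ScenarioCensus.DiffusionMeter

namespace Summit.NavierStokesRegularity.NavierStokesRegularity.Theorems.ScenarioCensus

/-! ## Census KEYS (ns `…Theorems.ScenarioCensus`): instrument DIFFUSION METER (block A2) — TREE-decided cells A2ml / A2cd / A2cdb / A2lap / A2lapb, OPEN rows A2lapU / A2cdU -/

/-- **Cell A2ml** (coarse Morrey law: `√s ‖e^{sΔ}u(t)‖_∞ ≤ L(C)` for every `s > 0` on `A_C`): `:= DiffusionMeter.Row_A2ml`. DECIDED (structural law). -/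
def Row_A2ml : Prop := DiffusionMeter.Row_A2ml
/-- A2ml is EXCLUDED (decided in the tree): `DiffusionMeter.row_A2ml`. -/
theorem row_A2ml_excluded : Row_A2ml := DiffusionMeter.row_A2ml

/-- **Cell A2cd** (caloric-defect cell at scale `Λ(C)`, amplitude `1/4` ⇒ `u ≡ 0`): `:= DiffusionMeter.Row_A2cd`. DECIDED. -/
def Row_A2cd : Prop := DiffusionMeter.Row_A2cd
/-- A2cd is EXCLUDED (decided in the tree): `DiffusionMeter.row_A2cd`. -/
theorem row_A2cd_excluded : Row_A2cd := DiffusionMeter.row_A2cd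

/-- **Cell A2cdb** (the caloric-defect cell on a backward end): `:= DiffusionMeter.Row_A2cdb`. DECIDED. -/
def Row_A2cdb : Prop := DiffusionMeter.Row_A2cdb
/-- A2cdb is EXCLUDED (decided in the tree): `DiffusionMeter.row_A2cdb`. -/
theorem row_A2cdb_excluded : Row_A2cdb := DiffusionMeter.row_A2cdb

/-- **Cell A2lap** (viscous-force cell `(−t)^{3/2}‖Δu‖ ≤ γ(C)` ⇒ `u ≡ 0`): `:= DiffusionMeter.Row_A2lap`. DECIDED (independence not claimed). -/
def Row_A2lap : Prop := DiffusionMeter.Row_A2lap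
/-- A2lap is EXCLUDED (decided in the tree): `DiffusionMeter.row_A2lap`. -/
theorem row_A2lap_excluded : Row_A2lap := DiffusionMeter.row_A2lap

/-- **Cell A2lapb** (the viscous-force cell on a backward end): `:= DiffusionMeter.Row_A2lapb`. DECIDED. -/
def Row_A2lapb : Prop := DiffusionMeter.Row_A2lapb
/-- A2lapb is EXCLUDED (decided in the tree): `DiffusionMeter.row_A2lapb`. -/
theorem row_A2lapb_excluded : Row_A2lapb := DiffusionMeter.row_A2lapb

/-- **Row A2lapU** (universal viscous-force threshold) — typed only: `:= DiffusionMeter.Row_A2lapU`. OPEN (no witness, no proof). -/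
@[conjecture] def Row_A2lapU : Prop := DiffusionMeter.Row_A2lapU

/-- **Row A2cdU** (universal caloric scale) — typed only: `:= DiffusionMeter.Row_A2cdU`. OPEN (no witness, no proof). -/
@[conjecture] def Row_A2cdU : Prop := DiffusionMeter.Row_A2cdU

/-- Lattice edge at key level: A2lapU implies A2lap (`DiffusionMeter.row_A2lapU_imp`). -/
theorem row_A2lap_of_row_A2lapU : Row_A2lapU → Row_A2lap := DiffusionMeter.row_A2lapU_imp
/-- Lattice edge at key level: A2cdU implies A2cd (`DiffusionMeter.row_A2cdU_imp`). -/
theorem row_A2cd_of_row_A2cdU : Row_A2cdU → Row_A2cd := DiffusionMeter.row_A2cdU_imp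

end Summit.NavierStokesRegularity.NavierStokesRegularity.Theorems.ScenarioCensus

end
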